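import Summits.HubbardSuperconductivity.HubbardSuperconductivity.Theorems.WeakCouplingBCSDefsKlCertTPrime
import Summits.HubbardSuperconductivity.HubbardSuperconductivity.Theorems.WeakCouplingBCSDefsKlCertB1gWinBRecord

/-!
# KL-MARGIN-SCAN reader hubbard-klscan-idea-4 (lens «cascade»), round 7, PART B —
# the van Hove POLE of the iso-density line `δ = ⅛` and the TWO-ENDPOINT REDUCTION of HQ1 (iii)
# (crux idea «vh-pole-endpoint-reduction» on `stmt-HubbardSuperconductivity-0158`; companion PART A = the saddle-row selection rules)

HQ1 (iii) of the H0-direct experiment «KL-MARGIN-SCAN» (director-hubbard g16, cell INBOX l.280) asks whether the sign of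
`B1g − next channel` of the second-order Kohn–Luttinger vertex crosses along `t′ ∈ [−0.3, 0]` at fixed hole doping `δ = ⅛`.
In float (margin-1 g14, SCAN-TABLE v0 TABLE C, 16 nodes, N = 1024/512) it never crosses: `B1g` leads at every node, the margin
is smallest at the two ENDS (`0.245` at `t′ = 0`, `0.240` at `t′ = −0.3`) and has a POLE at the van Hove crossing `t′* ≈ −0.150`
(`μ(⅛; t′*) = 4t′*`).  A certified «no crossing on the segment» is a CONTINUUM statement; a cover by certified `t′`-boxes is
priced dead (≈ 50–75 box cells × ≥ 100 core-h each against a 180 core-h grant, reader census r7).  This file types the cascade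
that replaces the cover by the two endpoint cells — which in print are exactly the two panels Fig. 1 (a) `t′ = 0` /
(b) `t′ = −0.3t` of Arovas–Berg–Kivelson–Raghu (2022) — plus ONE shape hypothesis:

* §3 the `δ = ⅛` line in the TPRIME vocabulary (`lineMu`, `lineVHDist`, `lineBottom χ`, `lineGap χ = λ_χ − λ_{B1g}`), the point
  form `LinePointDominates` of `KLB1gDominatesAtTP` (`linePointDominates_iff : … ↔ ∀ χ ≠ B1g, γ ≤ G_χ(t′)`), HQ1 (iii) as
  `SegmentDominatesRecord γ` (VH-excluded convention `|μ − 4t′| < 1/40`) and the stronger punctured form, the «zero crossings»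
  reading `noCrossing_of_segment`, and the `t′ = 0` endpoint from the landed window record B
  (`linePointDominates_zero_of_recordB`, modulo its enclosures and the `δ`-reading `μ(⅛; 0) ∈ [−0.3775, −0.2275]`);
* §4 the crux **K1 «iso-density unimodality»** (`IsoDensityUnimodal t*`: every rival gap `G_χ` along the line is antitone on
  `(t*, 0]` and monotone on `[−0.3, t*)` — it grows toward the pole from both ends; HYPOTHESIS, float support: all 112 one-step
  differences of the four rival gaps at N = 1024 and N = 512 have the predicted sign, smallest `+0.018`), its weakest sufficient
  form `EndpointMinimal`, the PROVED glue `segment_of_endpoints : EndpointMinimal t* → (⅛,0) cell → (⅛,−0.3) cell →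
  SegmentDominatesPunctured (min γ₀ γ₁)` and `hq1iii_noCrossing_of_K1`; then the two TIERS of K1 — the near-pole tier
  `NearVHUnimodal` (owned by PART A's selection rules: rival saddle rows vanish, the `B1g` row is the antisymmetric two-saddle
  Lindhard combination) and the far tier `FarUnimodal` with its certificate KIND, one-signed `t′`-derivative words
  (`LineGapFallsOn` / `LineGapRisesOn` ⇒ antitone / monotone by the mean value theorem, `farUnimodal_of_words`) — and the typed
  cheapest falsifier `not_unimodal_of_reversed_pair`.

Honest framing.  §3–§4 are definitions, one-line order facts and glue.  K1 is a HYPOTHESIS (float-supported, not certified; no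
analytic proof of its far tier is offered, and no `t′`-derivative certificate engine exists — cost unmeasured); the `(⅛, −0.3)`
endpoint is the conclusion SHAPE of kit job j320108 (margin-1 g15, in flight when this was written) and enters as a hypothesis;
the `t′ = 0` endpoint is the tree's record B modulo `klCertB1gWinB.EnclosuresB1g`; the van Hove crossing `t*` is a parameter
(continuity of `t′ ↦ μ(⅛; t′)` is not in the tree).  Floats quoted in docstrings are floats.  Nothing here asserts a Kohn–Luttinger
margin at any `t′ ≠ 0`, K₃, `U₀`, the window or superconductivity; a Kohn–Luttinger `O(U²)` channel statement is not ODLRO and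
nothing here proves superconductivity in the Hubbard model; no `t′ ≠ 0` statement chains to the summit Statement
(`squareDispersion 1 0`).  Zero kit.

References: D. P. Arovas, E. Berg, S. A. Kivelson, S. Raghu, Ann. Rev. CMP 13 (2022) 239, Fig. 1 (a)/(b), p. 14 (arXiv:2103.12097);
S. Raghu, S. A. Kivelson, D. J. Scalapino, Phys. Rev. B 81 (2010) 224505, §III and Fig. 3 (arXiv:1002.0591); R. Hlubina, Phys. Rev.
B 59 (1999) 9600 (weak-coupling `t`–`t′` phase diagram, van Hove line); tree `Theorems/WeakCouplingBCSDefsKlCertTPrime` (p665271,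
§3–§4: `klMuOfDopingTP`, `klVHExcludedTP`, `KLB1gDominatesAtTP`, `klB1gDominatesAtTP_zero_of_checkB1gD`),
`Theorems/WeakCouplingBCSDefsKlCertB1gWinBRecord` (`klCertB1gWinB`, `klCertB1gWinB_check`).
AI-produced formalisation (H21, cell gate-hubbard-kl, seat hubbard-klscan-idea-4 g7, 2026-08-29).
-/

noncomputable section

set_option linter.dupNamespace false

namespace Summit.HubbardSuperconductivity.HubbardSuperconductivity.Theorems.KlVHPole

open Real Set Literature.MathematicalPhysics.QuantumLattice
open Summit.HubbardSuperconductivity.HubbardSuperconductivity.Theorems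
open Summit.HubbardSuperconductivity.HubbardSuperconductivity.Theorems.CwKLChiralWindow

/-! ### §3  The iso-density line `δ = ⅛` in the TPRIME vocabulary; HQ1 (iii) as a typed segment statement -/

/-- `μ(⅛; t′)`: the free-band chemical potential at hole doping `⅛` along the `t′`-line (float: `−0.2366` at `t′ = 0`,
`−0.9596` at `t′ = −0.3`; not asserted). [cite: RaghuKivelsonScalapino2010, §II (4)] -/
def lineMu (tp : ℝ) : ℝ := klMuOfDopingTP tp (1 / 8)

/-- The van Hove distance `d(t′) = |μ(⅛; t′) − 4t′|` along the line (float: `0.2366` at `t′ = 0`, `0.2404` at `t′ = −0.3`, one zero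
at `t′* ≈ −0.1503`; not asserted). [folklore] -/
def lineVHDist (tp : ℝ) : ℝ := |lineMu tp - klVanHoveLevelTP tp|

/-- The channel bottom of sector `χ` at `U = 1` along the line: `λ_χ(t′) = channelInf ε_{t′} μ(⅛;t′) 1 χ`. [cite: RaghuKivelsonScalapino2010, §II (13)] -/
def lineBottom (χ : D4Irrep) (tp : ℝ) : ℝ := channelInf (squareDispersion 1 tp) (lineMu tp) 1 χ

/-- The rival gap of sector `χ` along the line: `G_χ(t′) = λ_χ(t′) − λ_{B1g}(t′)` (the margin is `min_{χ ≠ B1g} G_χ`).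
[cite: RaghuKivelsonScalapino2010, §III Fig. 3] -/
def lineGap (χ : D4Irrep) (tp : ℝ) : ℝ := lineBottom χ tp - lineBottom D4Irrep.B1g tp

/-- `B1g` dominance with margin `γ` AT the line point `(⅛, t′)`: the TPRIME window statement on the degenerate window
`[μ(⅛;t′), μ(⅛;t′)]`. [cite: RaghuKivelsonScalapino2010, §II (13)] -/
def LinePointDominates (tp γ : ℝ) : Prop := KLB1gDominatesAtTP tp (lineMu tp) (lineMu tp) γ

/-- Point dominance is `γ ≤ G_χ(t′)` for every rival `χ`. [folklore] -/
theorem linePointDominates_iff {tp γ : ℝ} :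
    LinePointDominates tp γ ↔ ∀ χ : D4Irrep, χ ≠ D4Irrep.B1g → γ ≤ lineGap χ tp := by
  constructor
  · intro h χ hχ
    have h1 := h (lineMu tp) ⟨le_rfl, le_rfl⟩ χ hχ
    unfold lineGap lineBottom
    linarith
  · intro h μ hμ χ hχ
    have hμ' : μ = lineMu tp := le_antisymm hμ.2 hμ.1
    have h1 := h χ hχ
    unfold lineGap lineBottom at h1
    rw [hμ']
    linarith

/-- A TPRIME window conclusion restricts to the line point whose `μ` it contains (the `δ`-reading `μ(⅛;t′) ∈ [a, b]` is the
hypothesis). [folklore] -/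
theorem linePointDominates_of_window {tp a b γ : ℝ} (h : KLB1gDominatesAtTP tp a b γ) (hμ : lineMu tp ∈ Icc a b) :
    LinePointDominates tp γ := by
  intro μ hμ' χ hχ
  have hμ'' : μ = lineMu tp := le_antisymm hμ'.2 hμ'.1
  rw [hμ'']
  exact h (lineMu tp) hμ χ hχ

/-- Point dominance is monotone in the margin. [folklore] -/
theorem linePointDominates_mono {tp γ γ' : ℝ} (h : LinePointDominates tp γ) (hle : γ' ≤ γ) : LinePointDominates tp γ' := by
  rw [linePointDominates_iff] at h ⊢
  exact fun χ hχ => le_trans hle (h χ hχ)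

/-- **HQ1 (iii), record form**: `B1g` leads by `γ` at every point of the segment `t′ ∈ [−0.3, 0]`, `δ = ⅛`, outside the adopted
van Hove exclusion `|μ − 4t′| < 1/40` (SCAN-TABLE v0.2 convention `klVHExcludedTP`). [folklore] -/
def SegmentDominatesRecord (γ : ℝ) : Prop :=
  ∀ tp ∈ Icc (-3 / 10 : ℝ) 0, ¬ klVHExcludedTP tp (1 / 8) → LinePointDominates tp γ

/-- **HQ1 (iii), punctured form** (stronger): the same at every point of the segment except the van Hove crossing itself. [folklore] -/
def SegmentDominatesPunctured (γ : ℝ) : Prop :=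
  ∀ tp ∈ Icc (-3 / 10 : ℝ) 0, lineVHDist tp ≠ 0 → LinePointDominates tp γ

/-- Punctured ⇒ record form (an excluded point has `d < 1/40`, a non-excluded one `d ≥ 1/40 > 0`). [folklore] -/
theorem segmentDominatesRecord_of_punctured {γ : ℝ} (h : SegmentDominatesPunctured γ) : SegmentDominatesRecord γ := by
  intro tp htp hex
  refine h tp htp (fun h0 => hex ?_)
  have h0' : |klMuOfDopingTP tp (1 / 8) - klVanHoveLevelTP tp| = 0 := h0
  show |klMuOfDopingTP tp (1 / 8) - klVanHoveLevelTP tp| < 1 / 40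
  rw [h0']; norm_num

/-- **«No crossing» reading**: a positive segment margin means `λ_{B1g} < λ_χ` strictly for every rival `χ` at every admissible point —
the sign of `B1g − next channel` is constant (negative) along the segment: ZERO crossings. [folklore] -/
theorem noCrossing_of_segment {γ : ℝ} (h : SegmentDominatesRecord γ) (hγ : 0 < γ) :
    ∀ tp ∈ Icc (-3 / 10 : ℝ) 0, ¬ klVHExcludedTP tp (1 / 8) →
      ∀ χ : D4Irrep, χ ≠ D4Irrep.B1g → lineBottom D4Irrep.B1g tp < lineBottom χ tp := by
  intro tp htp hex χ hχ
  have h1 := (linePointDominates_iff.1 (h tp htp hex)) χ hχ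
  unfold lineGap at h1
  linarith

/-- **The `t′ = 0` endpoint from the landed window record B** (`μ ∈ [−0.3775, −0.2275]`, `γ_B = 437/16384 ≈ 0.0267`), modulo its
certified enclosures (tree convention) and the `δ`-reading `μ(⅛; 0) ∈ [−0.3775, −0.2275]` (float `−0.2366`).
[cite: RaghuKivelsonScalapino2010, §III Fig. 2] -/
theorem linePointDominates_zero_of_recordB (hE : klCertB1gWinB.EnclosuresB1g)
    (hμ : lineMu 0 ∈ Icc (-0.3775 : ℝ) (-0.2275)) : LinePointDominates 0 (437 / 16384) := by
  have w := klB1gDominatesAtTP_zero_of_checkB1gD klCertB1gWinB klCertB1gWinB_check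
    ((KLCert.enclosuresB1gTP_zero _).2 hE)
  have lo : (((klCertB1gWinB).mub : ℚ) : ℝ) = -0.3775 := by
    show ((((-151 : ℚ) / 400) : ℚ) : ℝ) = -0.3775
    norm_num
  have hi : (((klCertB1gWinB).mua : ℚ) : ℝ) = -0.2275 := by
    show ((((-91 : ℚ) / 400) : ℚ) : ℝ) = -0.2275
    norm_num
  have ga : (((klCertB1gWinB).gamma : ℚ) : ℝ) = 437 / 16384 := by
    show ((((437 : ℚ) / 16384) : ℚ) : ℝ) = 437 / 16384
    norm_num
  rw [lo, hi, ga] at w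
  exact linePointDominates_of_window w hμ

/-! ### §4  The crux K1 «iso-density unimodality», its tiers, and the two-endpoint glue -/

/-- **K1 (crux, shape hypothesis): iso-density unimodality about the van Hove crossing `t*`.**  Every rival gap `G_χ` is
antitone on `(t*, 0]` (it FALLS as `t′` moves from the pole to `0`) and monotone on `[−0.3, t*)` (it RISES from `−0.3` to the pole).
Float support (SCAN-TABLE v0 TABLE C, step `0.02`): all `4 × 7 × 2` one-step differences have the predicted sign at N = 1024 AND
N = 512 (smallest `+0.018`, `Γ`-side `E`); NOT certified; no analytic proof offered for the far tier; orientation in print: the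
`d_{x²−y²}` coupling is enhanced as `|μ − 4t′| → 0` for `|t′|` below the two-patch threshold. [cite: RaghuKivelsonScalapino2010, §III] -/
def IsoDensityUnimodal (tstar : ℝ) : Prop :=
  ∀ χ : D4Irrep, χ ≠ D4Irrep.B1g →
    AntitoneOn (lineGap χ) (Ioc tstar 0) ∧ MonotoneOn (lineGap χ) (Ico (-3 / 10 : ℝ) tstar)

/-- **K1⁻ (the weakest sufficient form): endpoint-minimality** — on each side of `t*` every rival gap is at least its value at the
far endpoint of that side. [folklore] -/
def EndpointMinimal (tstar : ℝ) : Prop :=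
  ∀ χ : D4Irrep, χ ≠ D4Irrep.B1g →
    (∀ tp ∈ Ioc tstar 0, lineGap χ 0 ≤ lineGap χ tp) ∧
    (∀ tp ∈ Ico (-3 / 10 : ℝ) tstar, lineGap χ (-3 / 10) ≤ lineGap χ tp)

/-- Unimodality ⇒ endpoint-minimality. [folklore] -/
theorem endpointMinimal_of_unimodal {tstar : ℝ} (hts : tstar ∈ Ioo (-3 / 10 : ℝ) 0) (h : IsoDensityUnimodal tstar) :
    EndpointMinimal tstar := by
  intro χ hχ
  refine ⟨fun tp htp => ?_, fun tp htp => ?_⟩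
  · exact (h χ hχ).1 htp ⟨hts.2, le_rfl⟩ htp.2
  · exact (h χ hχ).2 ⟨le_rfl, hts.1⟩ htp htp.1

/-- **THE GLUE (two-endpoint reduction).**  If the van Hove crossing `t*` lies inside the segment and endpoint-minimality holds about
it, the two ENDPOINT cells `(⅛, 0)` (margin `γ₀`) and `(⅛, −0.3)` (margin `γ₁`) give `B1g` dominance by `min γ₀ γ₁` at every point
of the segment other than `t*` — no `t′`-modulus, no interior cell. [folklore] -/
theorem segment_of_endpoints {tstar γ₀ γ₁ : ℝ} (hVH : lineVHDist tstar = 0)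
    (hmin : EndpointMinimal tstar) (h0 : LinePointDominates 0 γ₀) (h1 : LinePointDominates (-3 / 10) γ₁) :
    SegmentDominatesPunctured (min γ₀ γ₁) := by
  intro tp htp hd
  have hne : tp ≠ tstar := by
    intro h
    apply hd
    rw [h]
    exact hVH
  rw [linePointDominates_iff] at h0 h1 ⊢
  intro χ hχ
  rcases lt_or_gt_of_ne hne with hlt | hgt
  · have h2 := (hmin χ hχ).2 tp ⟨htp.1, hlt⟩
    exact le_trans (min_le_right _ _) (le_trans (h1 χ hχ) h2)
  · have h2 := (hmin χ hχ).1 tp ⟨hgt, htp.2⟩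
    exact le_trans (min_le_left _ _) (le_trans (h0 χ hχ) h2)

/-- **K1 packaged (HYPOTHESIS)**: there is a van Hove crossing `t* ∈ (−0.3, 0)` on the line about which the rival gaps are
unimodal (float-supported only; not certified; not a fact). -/
def K1IsoDensityUnimodal : Prop :=
  ∃ tstar ∈ Ioo (-3 / 10 : ℝ) 0, lineVHDist tstar = 0 ∧ IsoDensityUnimodal tstar

/-- **HQ1 (iii) «no crossing» from K1 and the two endpoint cells** (record form, margin `min γ₀ γ₁`). [folklore] -/
theorem hq1iii_of_K1 {γ₀ γ₁ : ℝ} (hK : K1IsoDensityUnimodal) (h0 : LinePointDominates 0 γ₀)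
    (h1 : LinePointDominates (-3 / 10) γ₁) : SegmentDominatesRecord (min γ₀ γ₁) := by
  obtain ⟨tstar, hts, hVH, hU⟩ := hK
  exact segmentDominatesRecord_of_punctured
    (segment_of_endpoints hVH (endpointMinimal_of_unimodal hts hU) h0 h1)

/-- **The assembled reading of record**: K1 + the tree's `t′ = 0` record B (modulo enclosures, with the `δ`-reading at `t′ = 0`) +
ONE certified `(⅛, −0.3)` cell `KLB1gDominatesAtTP (−3/10) a b γ₁` containing `μ(⅛; −0.3)` (the shape of kit job j320108's conclusion)
⇒ HQ1 (iii) holds as «zero crossings, margin `min(437/16384, γ₁)`» on the whole admissible segment. [cite: RaghuKivelsonScalapino2010, §III Fig. 3] -/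
theorem hq1iii_noCrossing_of_K1 (hK : K1IsoDensityUnimodal) (hE : klCertB1gWinB.EnclosuresB1g)
    (hμ0 : lineMu 0 ∈ Icc (-0.3775 : ℝ) (-0.2275)) {a b γ₁ : ℝ} (h1 : KLB1gDominatesAtTP (-3 / 10) a b γ₁)
    (hμ1 : lineMu (-3 / 10) ∈ Icc a b) : SegmentDominatesRecord (min (437 / 16384) γ₁) :=
  hq1iii_of_K1 hK (linePointDominates_zero_of_recordB hE hμ0) (linePointDominates_of_window h1 hμ1)

/-! #### The two tiers of K1 and the far-tier certificate kind -/

/-- Antitone pieces abutting at a shared point glue. [folklore] -/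
theorem antitoneOn_Ioc_of_pieces {f : ℝ → ℝ} {a b c : ℝ} (hab : a < b) (hbc : b ≤ c)
    (h₁ : AntitoneOn f (Ioc a b)) (h₂ : AntitoneOn f (Icc b c)) : AntitoneOn f (Ioc a c) := by
  intro x hx y hy hxy
  rcases le_or_gt y b with hyb | hyb
  · exact h₁ ⟨hx.1, le_trans hxy hyb⟩ ⟨hy.1, hyb⟩ hxy
  · rcases le_or_gt x b with hxb | hxb
    · exact le_trans (h₂ ⟨le_rfl, hbc⟩ ⟨hyb.le, hy.2⟩ hyb.le) (h₁ ⟨hx.1, hxb⟩ ⟨hab, le_rfl⟩ hxb)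
    · exact h₂ ⟨hxb.le, le_trans hxy hy.2⟩ ⟨hyb.le, hy.2⟩ hxy

/-- Monotone pieces abutting at a shared point glue. [folklore] -/
theorem monotoneOn_Ico_of_pieces {f : ℝ → ℝ} {a b c : ℝ} (hab : a ≤ b) (hbc : b < c)
    (h₁ : MonotoneOn f (Icc a b)) (h₂ : MonotoneOn f (Ico b c)) : MonotoneOn f (Ico a c) := by
  intro x hx y hy hxy
  rcases le_or_gt b x with hxb | hxb
  · exact h₂ ⟨hxb, hx.2⟩ ⟨le_trans hxb hxy, hy.2⟩ hxy
  · rcases le_or_gt b y with hyb | hyb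
    · exact le_trans (h₁ ⟨hx.1, hxb.le⟩ ⟨hab, le_rfl⟩ hxb.le) (h₂ ⟨le_rfl, hbc⟩ ⟨hyb, hy.2⟩ hyb)
    · exact h₁ ⟨hx.1, hxb.le⟩ ⟨hy.1, hyb.le⟩ hxy

/-- Two closed antitone pieces glue. [folklore] -/
theorem antitoneOn_Icc_of_pieces {f : ℝ → ℝ} {a b c : ℝ} (hab : a ≤ b) (hbc : b ≤ c)
    (h₁ : AntitoneOn f (Icc a b)) (h₂ : AntitoneOn f (Icc b c)) : AntitoneOn f (Icc a c) := by
  intro x hx y hy hxy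
  rcases le_or_gt y b with hyb | hyb
  · exact h₁ ⟨hx.1, le_trans hxy hyb⟩ ⟨hy.1, hyb⟩ hxy
  · rcases le_or_gt x b with hxb | hxb
    · exact le_trans (h₂ ⟨le_rfl, hbc⟩ ⟨hyb.le, hy.2⟩ hyb.le) (h₁ ⟨hx.1, hxb⟩ ⟨hab, le_rfl⟩ hxb)
    · exact h₂ ⟨hxb.le, le_trans hxy hy.2⟩ ⟨hyb.le, hy.2⟩ hxy

/-- **K1-near (the VH tier)**: unimodality on the punctured `η`-neighbourhood of the pole — the tier owned by the saddle mechanism of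
§1–§2 (rival saddle rows vanish, the `B1g` row is the antisymmetric two-saddle Lindhard combination; effective-monotone sharpening of
the `∃ η` statement `VHPeakedMarginTP` of reader idea-1's «saddle-sign-rule», enhanced side `R = 2|t′*| ≈ 0.30 < R⋆`). [cite: RaghuKivelsonScalapino2010, §III] -/
def NearVHUnimodal (tstar η : ℝ) : Prop :=
  ∀ χ : D4Irrep, χ ≠ D4Irrep.B1g →
    AntitoneOn (lineGap χ) (Ioc tstar (tstar + η)) ∧ MonotoneOn (lineGap χ) (Ico (tstar - η) tstar)

/-- **K1-far (the smooth tier)**: unimodality on the two closed far pieces `[t* + η, 0]` and `[−0.3, t* − η]`, where the Fermi curve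
stays `≥ η`-far (in `t′`) from the saddles — the tier a certificate engine can address by one-signed derivative words
(`LineGapFallsOn` / `LineGapRisesOn` below); float-supported only. [cite: RaghuKivelsonScalapino2010, §III Fig. 3] -/
def FarUnimodal (tstar η : ℝ) : Prop :=
  ∀ χ : D4Irrep, χ ≠ D4Irrep.B1g →
    AntitoneOn (lineGap χ) (Icc (tstar + η) 0) ∧ MonotoneOn (lineGap χ) (Icc (-3 / 10 : ℝ) (tstar - η))

/-- Near tier + far tier ⇒ K1 about `t*`. [folklore] -/
theorem unimodal_of_near_far {tstar η : ℝ} (hη : 0 < η) (h0 : tstar + η ≤ 0) (h3 : (-3 / 10 : ℝ) ≤ tstar - η)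
    (hn : NearVHUnimodal tstar η) (hf : FarUnimodal tstar η) : IsoDensityUnimodal tstar := by
  intro χ hχ
  obtain ⟨hn1, hn2⟩ := hn χ hχ
  obtain ⟨hf1, hf2⟩ := hf χ hχ
  exact ⟨antitoneOn_Ioc_of_pieces (by linarith) h0 hn1 hf1, monotoneOn_Ico_of_pieces h3 (by linarith) hf2 hn2⟩

/-- **Far-tier word (Γ side)**: on the `t′`-box `[lo, hi]` the rival gap `G_χ` is continuous, differentiable inside, with
non-positive `t′`-derivative («falls toward `t′ = 0`»).  The certificate KIND a `t′`-capable engine would have to emit for the far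
tier (Hellmann–Feynman derivative of the two bottoms along the line, sign only); none exists, cost unmeasured. [folklore] -/
def LineGapFallsOn (χ : D4Irrep) (lo hi : ℝ) : Prop :=
  ContinuousOn (lineGap χ) (Icc lo hi) ∧ DifferentiableOn ℝ (lineGap χ) (Ioo lo hi) ∧
    ∀ tp ∈ Ioo lo hi, deriv (lineGap χ) tp ≤ 0

/-- **Far-tier word (M side)**: non-negative `t′`-derivative («rises toward the pole»). [folklore] -/
def LineGapRisesOn (χ : D4Irrep) (lo hi : ℝ) : Prop :=
  ContinuousOn (lineGap χ) (Icc lo hi) ∧ DifferentiableOn ℝ (lineGap χ) (Ioo lo hi) ∧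
    ∀ tp ∈ Ioo lo hi, 0 ≤ deriv (lineGap χ) tp

/-- A falling word makes `G_χ` antitone on its box (mean value theorem, Mathlib `antitoneOn_of_deriv_nonpos`). [folklore] -/
theorem antitoneOn_Icc_of_fallsOn {χ : D4Irrep} {lo hi : ℝ} (h : LineGapFallsOn χ lo hi) :
    AntitoneOn (lineGap χ) (Icc lo hi) :=
  antitoneOn_of_deriv_nonpos (convex_Icc lo hi) h.1 (by rw [interior_Icc]; exact h.2.1)
    (by rw [interior_Icc]; exact h.2.2)

/-- A rising word makes `G_χ` monotone on its box. [folklore] -/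
theorem monotoneOn_Icc_of_risesOn {χ : D4Irrep} {lo hi : ℝ} (h : LineGapRisesOn χ lo hi) :
    MonotoneOn (lineGap χ) (Icc lo hi) :=
  monotoneOn_of_deriv_nonneg (convex_Icc lo hi) h.1 (by rw [interior_Icc]; exact h.2.1)
    (by rw [interior_Icc]; exact h.2.2)

/-- **Far tier from words**: two abutting falling words per rival on the `Γ` side and two abutting rising words on the `M` side give
`FarUnimodal` (shown for a two-box chain per side; longer chains iterate `antitoneOn_Icc_of_pieces`). [folklore] -/
theorem farUnimodal_of_words {tstar η m₁ m₂ : ℝ} (hm₁ : tstar + η ≤ m₁) (hm₁' : m₁ ≤ 0)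
    (hm₂ : (-3 / 10 : ℝ) ≤ m₂) (hm₂' : m₂ ≤ tstar - η)
    (hΓ : ∀ χ : D4Irrep, χ ≠ D4Irrep.B1g → LineGapFallsOn χ (tstar + η) m₁ ∧ LineGapFallsOn χ m₁ 0)
    (hM : ∀ χ : D4Irrep, χ ≠ D4Irrep.B1g → LineGapRisesOn χ (-3 / 10) m₂ ∧ LineGapRisesOn χ m₂ (tstar - η)) :
    FarUnimodal tstar η := by
  intro χ hχ
  obtain ⟨g1, g2⟩ := hΓ χ hχ
  obtain ⟨r1, r2⟩ := hM χ hχ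
  refine ⟨antitoneOn_Icc_of_pieces hm₁ hm₁' (antitoneOn_Icc_of_fallsOn g1) (antitoneOn_Icc_of_fallsOn g2), ?_⟩
  intro x hx y hy hxy
  have a1 := monotoneOn_Icc_of_risesOn r1
  have a2 := monotoneOn_Icc_of_risesOn r2
  rcases le_or_gt m₂ x with hxb | hxb
  · exact a2 ⟨hxb, hx.2⟩ ⟨le_trans hxb hxy, hy.2⟩ hxy
  · rcases le_or_gt m₂ y with hyb | hyb
    · exact le_trans (a1 ⟨hx.1, hxb.le⟩ ⟨hm₂, le_rfl⟩ hxb.le) (a2 ⟨le_rfl, hm₂'⟩ ⟨hyb, hy.2⟩ hyb)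
    · exact a1 ⟨hx.1, hxb.le⟩ ⟨hy.1, hyb.le⟩ hxy

/-- **Cheapest falsifier of K1, typed**: two certified cells on the SAME side of the pole whose rival-gap order contradicts the
predicted direction refute K1 for that `t*` (here the `Γ` side: a nearer-to-pole point with a certified SMALLER gap). [folklore] -/
theorem not_unimodal_of_reversed_pair {tstar t₁ t₂ : ℝ} {χ : D4Irrep} (hχ : χ ≠ D4Irrep.B1g)
    (h₁ : t₁ ∈ Ioc tstar 0) (h₂ : t₂ ∈ Ioc tstar 0) (h12 : t₁ ≤ t₂) (hrev : lineGap χ t₁ < lineGap χ t₂) :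
    ¬ IsoDensityUnimodal tstar := by
  intro hU
  have h := (hU χ hχ).1 h₁ h₂ h12
  linarith

end Summit.HubbardSuperconductivity.HubbardSuperconductivity.Theorems.KlVHPole

end
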